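import Summits.BirchSwinnertonDyer.Rank1Residual.X9.PrintCertHeegnerCertifiedX10b
import Summits.BirchSwinnertonDyer.Rank1Residual.X9.PrintCertHeegnerCertifiedX9Ns
import Summits.BirchSwinnertonDyer.Rank1Residual.X9.PrintCertHeegnerCertifiedX9S4AB
import Summits.BirchSwinnertonDyer.Rank1Residual.X9.PrintCertHeegnerCertifiedX9S4CD
import Summits.BirchSwinnertonDyer.Rank1Residual.X9.PrintCertTamagawaCensus
import Summits.BirchSwinnertonDyer.Rank1Residual.X9.PrintCertRecordsCertifiedX9S4R0
import HarnessLib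

/-!
# Leaves X9 / X10b — KERNEL CENSUS of the Heegner frames and the J-screen over ALL rank-1 certificate records (one-stop file)

HONEST FRAMING (cell `bsd-print-x9`, D-0131 (2) print tier): theorems about the cell's DATA records, evaluated IN THE KERNEL; no named
fact; nothing asserted about any elliptic curve beyond the per-record frame identities of `X9/PrintCertHeegnerCertified*.lean`; no pair is
booked; no leaf is closed (`BSDpOnClassX9`, `BSDpOnClassX10b` stay `@[conjecture]`; cruxes J = item 20392, J₃ = item 21340 stay OPEN — they say
`∃ B, ∀ |d_K| > B, …`, which no finite table refutes). The census is a statement about THESE records, not about the leaves.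

* `heegnerCertsAllX9` (415 certificates = every rank-`1` X9 record) / `heegnerCertsX10bNsR1` (39 = every rank-`1` X10b record);
  `exists_heegnerCheck_of_mem_allX9 / _allX10b`: every rank-`1` record of `allX9` / `allX10b` has a passing Heegner frame certificate;
  `frame_of_mem_allX9 / _allX10b`, `screen_of_mem_allX9 / _allX10b`: the frame binders of J / J₃ for any imaginary quadratic `K` with the
  certificate's discriminant, and `ord_p ∏ c_ℓ(W) ≤ v_p(m_K)`, for any globally minimal `W` with the record's integral model.
* `screenCensus_allX9`: 415 frames, `v_p(m_K) = t` on 381, `> t` on 34, `< t` on 0; on the 96 J-LIVE records (`p ∣ ∏ c_ℓ`, where crux J is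
  load-bearing in p4's kernel): `= t` on 95, `> t` on 1 (274752s1), `< t` on 0; `|d_K| ≤ 839`.
* `screenCensus_allX10b`: 39 frames (all J₃-live, `d_K ≡ 1 (mod 8)`), `= t` on 33, `> t` on 6 (37510l1, 223850j1, 303710q1, 413440j1, 427130u1, 461978l1), `< t` on 0; `|d_K| ≤ 2279.

References: [Jetchev2008] Conj. 1.1, Rem. 1.2, Thm. 1.4; [GrossZagier1986] V (2.1)–(2.3); [GrossLMS1991] §1; [Marcus1977] Ch. 3 Thm. 25.
-/

set_option autoImplicit false

namespace Summit.BirchSwinnertonDyer.Rank1Residual.X9.PrintCert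

open WeierstrassCurve Summit.BirchSwinnertonDyer.Rank1Residual.Additive
open Literature.NumberTheory.EllipticCurves (IsImaginaryQuadratic SatisfiesHeegnerHypothesis)

/-- All 415 Heegner frame certificates of the rank-`1` X9 records (slices `Ns5A`, `Ns5B`, `Ns7`, `S4R1A`–`D`, in this order). [folklore] -/
def heegnerCertsAllX9 : List HeegnerCert :=
  heegnerCertsNs5A ++ heegnerCertsNs5B ++ heegnerCertsNs7 ++ heegnerCertsS4R1A ++ heegnerCertsS4R1B ++ heegnerCertsS4R1C ++ heegnerCertsS4R1D

-- kernel evaluation over all records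
set_option maxRecDepth 100000

/-- The rank-`0` slices of leaf X9 (`S4R0A`–`C`) and of leaf X10b (`X10bNn`, `X10bNsR0A`/`B`) contain no rank-`1` record (kernel). [folklore] -/
theorem rank_ne_one_of_rankZero_slices :
    (∀ r ∈ recordsS4R0A, r.rank ≠ 1) ∧ (∀ r ∈ recordsS4R0B, r.rank ≠ 1) ∧ (∀ r ∈ recordsS4R0C, r.rank ≠ 1) ∧
    (∀ r ∈ recordsX10bNn, r.rank ≠ 1) ∧ (∀ r ∈ recordsX10bNsR0A, r.rank ≠ 1) ∧ (∀ r ∈ recordsX10bNsR0B, r.rank ≠ 1) := by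
  refine ⟨?_, ?_, ?_, ?_, ?_, ?_⟩ <;> decide +kernel

/-- **Every rank-`1` X9 record has a passing Heegner frame certificate** (J frames: Heegner for `N`, `p` split). [cite: Jetchev2008, Conj. 1.1] -/
theorem exists_heegnerCheck_of_mem_allX9 {r : Record} (hr : r ∈ allX9) (h1 : r.rank = 1) :
    ∃ c ∈ heegnerCertsAllX9, r.heegnerCheck c = true := by
  obtain ⟨h0A, h0B, h0C, -, -, -⟩ := rank_ne_one_of_rankZero_slices
  simp only [allX9, List.mem_append] at hr
  simp only [heegnerCertsAllX9, List.mem_append]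
  rcases hr with ((((((((h | h) | h) | h) | h) | h) | h) | h) | h) | h
  · obtain ⟨c, hc, hh⟩ := exists_heegnerCheck_of_mem_Ns5A h h1; exact ⟨c, by tauto, hh⟩
  · obtain ⟨c, hc, hh⟩ := exists_heegnerCheck_of_mem_Ns5B h h1; exact ⟨c, by tauto, hh⟩
  · obtain ⟨c, hc, hh⟩ := exists_heegnerCheck_of_mem_Ns7 h h1; exact ⟨c, by tauto, hh⟩
  · exact absurd h1 (h0A r h)
  · exact absurd h1 (h0B r h)
  · exact absurd h1 (h0C r h)
  · obtain ⟨c, hc, hh⟩ := exists_heegnerCheck_of_mem_S4R1A h h1; exact ⟨c, by tauto, hh⟩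
  · obtain ⟨c, hc, hh⟩ := exists_heegnerCheck_of_mem_S4R1B h h1; exact ⟨c, by tauto, hh⟩
  · obtain ⟨c, hc, hh⟩ := exists_heegnerCheck_of_mem_S4R1C h h1; exact ⟨c, by tauto, hh⟩
  · obtain ⟨c, hc, hh⟩ := exists_heegnerCheck_of_mem_S4R1D h h1; exact ⟨c, by tauto, hh⟩

/-- **Every rank-`1` X10b record has a passing Heegner frame certificate** (J₃ frames: Heegner for `N`, `3` and `2` split). [cite: Jetchev2008, Conj. 1.1] -/
theorem exists_heegnerCheck_of_mem_allX10b {r : Record} (hr : r ∈ allX10b) (h1 : r.rank = 1) :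
    ∃ c ∈ heegnerCertsX10bNsR1, r.heegnerCheck c = true := by
  obtain ⟨-, -, -, hNn, hA, hB⟩ := rank_ne_one_of_rankZero_slices
  simp only [allX10b, List.mem_append] at hr
  rcases hr with ((h | h) | h) | h
  · exact absurd h1 (hNn r h)
  · exact absurd h1 (hA r h)
  · exact absurd h1 (hB r h)
  · exact exists_heegnerCheck_of_mem_X10bNsR1 h h1

/-- Every X9 record passes the schema recheck `Record.check` (the slices' `certified_<Slice>`). [folklore] -/
theorem check_of_mem_allX9 {r : Record} (hr : r ∈ allX9) : r.check = true := by
  simp only [allX9, List.mem_append] at hr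
  rcases hr with ((((((((h | h) | h) | h) | h) | h) | h) | h) | h) | h
  exacts [certified_Ns5A.check_of_mem h, certified_Ns5B.check_of_mem h, certified_Ns7.check_of_mem h,
    certified_S4R0A.check_of_mem h, certified_S4R0B.check_of_mem h, certified_S4R0C.check_of_mem h,
    certified_S4R1A.check_of_mem h, certified_S4R1B.check_of_mem h, certified_S4R1C.check_of_mem h,
    certified_S4R1D.check_of_mem h]

/-- Every X10b record passes the schema recheck `Record.check` (the slices' `certified_<Slice>`). [folklore] -/
theorem check_of_mem_allX10b {r : Record} (hr : r ∈ allX10b) : r.check = true := by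
  simp only [allX10b, List.mem_append] at hr
  rcases hr with ((h | h) | h) | h
  exacts [certified_X10bNn.check_of_mem h, certified_X10bNsR0A.check_of_mem h, certified_X10bNsR0B.check_of_mem h,
    certified_X10bNsR1.check_of_mem h]

/-- **THE FRAME over `allX9`**: for a rank-`1` record, ANY imaginary quadratic `K` with the certificate's discriminant satisfies the
frame binders of crux J (item 20392) — Heegner hypothesis for `N(W)` and for `p`, `|d_K| > 4`, `4N ∣ β² − d_K` —
for ANY globally minimal `W` with the record's integral model. [cite: GrossLMS1991, §1 (p. 235)] [cite: Marcus1977, Ch. 3 Thm. 25] -/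
theorem frame_of_mem_allX9 {r : Record} (hr : r ∈ allX9) (h1 : r.rank = 1) {W : WeierstrassCurve ℚ} [W.IsElliptic]
    [W.IsGloballyMinimal] (hI : integralModelInt W = r.intCurve) {K : Type} [Field K] [NumberField K]
    (hK : IsImaginaryQuadratic K) {q : ℕ} (hq : q = r.p) :
    ∃ c ∈ heegnerCertsAllX9, r.heegnerCheck c = true ∧ (NumberField.discr K = c.D →
      SatisfiesHeegnerHypothesis (W.conductorNorm ℤ) K ∧ SatisfiesHeegnerHypothesis q K ∧ 4 < (NumberField.discr K).natAbs ∧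
      (4 * (r.conductor : ℤ)) ∣ (c.beta : ℤ) ^ 2 - NumberField.discr K ∧ (q = 3 → NumberField.discr K % 8 = 1)) := by
  obtain ⟨c, hc, hh⟩ := exists_heegnerCheck_of_mem_allX9 hr h1
  exact ⟨c, hc, hh, fun hd => Record.frame_of_heegnerCheck hI (check_of_mem_allX9 hr) hh hK hd hq⟩

/-- **THE SCREEN over `allX9`**: `ord_p ∏_ℓ c_ℓ(W) ≤ v_p(m_K)` and `2·v_p(m_K) = 2·ord_p ∏_ℓ c_ℓ(W) + v_p(#Ш_an(E)·#Ш_an(E^D))` in the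
kernel's currency, for a rank-`1` record and any globally minimal `W` with its integral model (`m_K`, `#Ш_an(E^D)`: two-engine claims
of the display files). [cite: Jetchev2008, Conj. 1.1, Thm. 1.4] -/
theorem screen_of_mem_allX9 {r : Record} (hr : r ∈ allX9) (h1 : r.rank = 1) {W : WeierstrassCurve ℚ} [W.IsElliptic]
    [W.IsGloballyMinimal] (hI : integralModelInt W = r.intCurve) {q : ℕ} (hq : q = r.p) :
    ∃ c ∈ heegnerCertsAllX9, r.heegnerCheck c = true ∧ padicValNat q W.tamagawaProduct ≤ c.indexVal ∧
      2 * c.indexVal = 2 * padicValNat q W.tamagawaProduct + padicValNat q (r.shaAn * c.twistSha) := by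
  obtain ⟨c, hc, hh⟩ := exists_heegnerCheck_of_mem_allX9 hr h1
  obtain ⟨tc, htc⟩ := exists_tamCheck_of_mem_allX9 hr
  exact ⟨c, hc, hh, Record.padicValNat_tamagawaProduct_le_indexVal_of_heegnerCheck hI hh htc hq,
    Record.two_mul_indexVal_eq_of_heegnerCheck hI hh htc hq⟩

/-- **THE FRAME over `allX10b`**: for a rank-`1` record, ANY imaginary quadratic `K` with the certificate's discriminant satisfies the
frame binders of crux J₃ (item 21340; incl. `d_K ≡ 1 (mod 8)`) — Heegner hypothesis for `N(W)` and for `p`, `|d_K| > 4`, `4N ∣ β² − d_K` —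
for ANY globally minimal `W` with the record's integral model. [cite: GrossLMS1991, §1 (p. 235)] [cite: Marcus1977, Ch. 3 Thm. 25] -/
theorem frame_of_mem_allX10b {r : Record} (hr : r ∈ allX10b) (h1 : r.rank = 1) {W : WeierstrassCurve ℚ} [W.IsElliptic]
    [W.IsGloballyMinimal] (hI : integralModelInt W = r.intCurve) {K : Type} [Field K] [NumberField K]
    (hK : IsImaginaryQuadratic K) {q : ℕ} (hq : q = r.p) :
    ∃ c ∈ heegnerCertsX10bNsR1, r.heegnerCheck c = true ∧ (NumberField.discr K = c.D →
      SatisfiesHeegnerHypothesis (W.conductorNorm ℤ) K ∧ SatisfiesHeegnerHypothesis q K ∧ 4 < (NumberField.discr K).natAbs ∧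
      (4 * (r.conductor : ℤ)) ∣ (c.beta : ℤ) ^ 2 - NumberField.discr K ∧ (q = 3 → NumberField.discr K % 8 = 1)) := by
  obtain ⟨c, hc, hh⟩ := exists_heegnerCheck_of_mem_allX10b hr h1
  exact ⟨c, hc, hh, fun hd => Record.frame_of_heegnerCheck hI (check_of_mem_allX10b hr) hh hK hd hq⟩

/-- **THE SCREEN over `allX10b`**: `ord_p ∏_ℓ c_ℓ(W) ≤ v_p(m_K)` and `2·v_p(m_K) = 2·ord_p ∏_ℓ c_ℓ(W) + v_p(#Ш_an(E)·#Ш_an(E^D))` in the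
kernel's currency, for a rank-`1` record and any globally minimal `W` with its integral model (`m_K`, `#Ш_an(E^D)`: two-engine claims
of the display files). [cite: Jetchev2008, Conj. 1.1, Thm. 1.4] -/
theorem screen_of_mem_allX10b {r : Record} (hr : r ∈ allX10b) (h1 : r.rank = 1) {W : WeierstrassCurve ℚ} [W.IsElliptic]
    [W.IsGloballyMinimal] (hI : integralModelInt W = r.intCurve) {q : ℕ} (hq : q = r.p) :
    ∃ c ∈ heegnerCertsX10bNsR1, r.heegnerCheck c = true ∧ padicValNat q W.tamagawaProduct ≤ c.indexVal ∧
      2 * c.indexVal = 2 * padicValNat q W.tamagawaProduct + padicValNat q (r.shaAn * c.twistSha) := by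
  obtain ⟨c, hc, hh⟩ := exists_heegnerCheck_of_mem_allX10b hr h1
  obtain ⟨tc, htc⟩ := exists_tamCheck_of_mem_allX10b hr
  exact ⟨c, hc, hh, Record.padicValNat_tamagawaProduct_le_indexVal_of_heegnerCheck hI hh htc hq,
    Record.two_mul_indexVal_eq_of_heegnerCheck hI hh htc hq⟩

/-- KERNEL CENSUS, leaf X9: 415 frames; `v_p(m_K) = t` on 381, `> t` on 34, `< t` on 0; among the 96 J-LIVE frames (`0 < t`): `= t` on 95,
`> t` on 1 (labels listed), `< t` on 0; every `|d_K| ≤ 839`. [cite: Jetchev2008, Conj. 1.1] -/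
theorem screenCensus_allX9 : heegnerCertsAllX9.length = 415 ∧
    (heegnerCertsAllX9.filter fun c => c.indexVal == c.depth).length = 381 ∧
    (heegnerCertsAllX9.filter fun c => decide (c.depth < c.indexVal)).length = 34 ∧
    (heegnerCertsAllX9.filter fun c => decide (c.indexVal < c.depth)).length = 0 ∧
    (heegnerCertsAllX9.filter fun c => decide (0 < c.depth)).length = 96 ∧
    (heegnerCertsAllX9.filter fun c => decide (0 < c.depth) && (c.indexVal == c.depth)).length = 95 ∧
    ((heegnerCertsAllX9.filter fun c => decide (0 < c.depth ∧ c.depth < c.indexVal)).map fun c => c.label) = ["274752s1"] ∧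
    (heegnerCertsAllX9.all fun c => decide (c.D.natAbs ≤ 839)) = true := by
  refine ⟨?_, ?_, ?_, ?_, ?_, ?_, ?_, ?_⟩ <;> decide +kernel

/-- KERNEL CENSUS, leaf X10b: 39 frames, all with `d_K ≡ 1 (mod 8)` and `0 < t`; `v_3(m_K) = t` on 33, `> t` on 6 (labels listed),
`< t` on 0; every `|d_K| ≤ 2279`. [cite: Jetchev2008, Conj. 1.1] -/
theorem screenCensus_allX10b : heegnerCertsX10bNsR1.length = 39 ∧
    (heegnerCertsX10bNsR1.all fun c => decide (c.D % 8 = 1 ∧ 0 < c.depth)) = true ∧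
    (heegnerCertsX10bNsR1.filter fun c => c.indexVal == c.depth).length = 33 ∧
    ((heegnerCertsX10bNsR1.filter fun c => decide (c.depth < c.indexVal)).map fun c => c.label) = ["37510l1", "223850j1", "303710q1", "413440j1", "427130u1", "461978l1"] ∧
    (heegnerCertsX10bNsR1.filter fun c => decide (c.indexVal < c.depth)).length = 0 ∧
    (heegnerCertsX10bNsR1.all fun c => decide (c.D.natAbs ≤ 2279)) = true := by
  refine ⟨?_, ?_, ?_, ?_, ?_, ?_⟩ <;> decide +kernel

end Summit.BirchSwinnertonDyer.Rank1Residual.X9.PrintCert
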